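import Mathlib

/-!
# The two `Γ large` length conditions of the stadium-area files, with explicit thresholds
# (`FilamentSkeletonRss`, child cruxes `TangentSkeletonNearStraight` 28295 / `TangentSkeletonNearStraightL` 23320, lines
# `child_tangent_analytic_strip(_L)`, ∃-side bookkeeping for the `StadiumAnalyticArea` conjunct)

`Theorems.AreaLawSlavingHolo.stadium_analytic_area_filament` (complex part 12) asks for the fit `1/(8Kw) < Rb·√(log Γ) + cs` of the near
rectangle, and `Theorems.StadiumRigidArea.stadiumAnalyticArea_of_rigid_core` for the length inequality
`Rw√Γ + (Rb√(Γ log Γ) + cs√Γ) ≤ 2Rb√(Γ log Γ)`.  Both hold for `Γ` beyond explicit thresholds (so they are absorbed in the `∃ Γ₂ ∀ Γ ≥ Γ₂`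
of the line's output):

* `sqrt_log_ge_of_exp_sq_le` — `0 ≤ a`, `exp(a²) ≤ Γ` ⇒ `a ≤ √(log Γ)`;
* `near_rect_fits_of_large` — `Kw, Rb > 0`, `0 ≤ cs`, `exp((1/(8Kw·Rb) + 1)²) ≤ Γ` ⇒ `1/(8Kw) < Rb√(log Γ) + cs`;
* `rigid_length_of_large` — `Rb > 0`, `0 ≤ Rw + cs`, `exp(((Rw + cs)/Rb)²) ≤ Γ` ⇒ `Rw√Γ + (Rb√(Γ log Γ) + cs√Γ) ≤ 2Rb√(Γ log Γ)`.

HONEST FRAMING: bookkeeping for a HYPOTHETICAL filament skeleton on the NEGATIVE side of a MODEL route; no registered stub is closed by this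
file and nothing here bears on Navier–Stokes regularity or blow-up.  `--supports stmt-NavierStokesRegularity-28295`.
-/

set_option linter.dupNamespace false

noncomputable section

namespace Summit.NavierStokesRegularity.NavierStokesRegularity.Theorems.StadiumLargeGamma

open Real

/-- `0 ≤ a` and `exp(a²) ≤ Γ` give `a ≤ √(log Γ)`. [folklore] -/
theorem sqrt_log_ge_of_exp_sq_le {a Γ : ℝ} (ha : 0 ≤ a) (hΓ : exp (a ^ 2) ≤ Γ) : a ≤ √(Real.log Γ) := by
  have hΓpos : 0 < Γ := lt_of_lt_of_le (exp_pos _) hΓ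
  have hlog : a ^ 2 ≤ Real.log Γ := by
    have := Real.log_le_log (exp_pos _) hΓ
    rwa [Real.log_exp] at this
  calc a = √(a ^ 2) := by rw [Real.sqrt_sq ha]
    _ ≤ √(Real.log Γ) := Real.sqrt_le_sqrt hlog

/-- **The near rectangle fits for `Γ` large.**  `Kw, Rb > 0`, `cs ≥ 0`, `exp((1/(8Kw·Rb) + 1)²) ≤ Γ` ⇒ `1/(8Kw) < Rb·√(log Γ) + cs`.
[folklore] -/
theorem near_rect_fits_of_large {Kw Rb cs Γ : ℝ} (hKw : 0 < Kw) (hRb : 0 < Rb) (hcs : 0 ≤ cs)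
    (hΓ : exp ((1 / (8 * Kw * Rb) + 1) ^ 2) ≤ Γ) : 1 / (8 * Kw) < Rb * √(Real.log Γ) + cs := by
  have ha : 0 ≤ 1 / (8 * Kw * Rb) + 1 := by positivity
  have h := sqrt_log_ge_of_exp_sq_le ha hΓ
  have h1 : 1 / (8 * Kw * Rb) < √(Real.log Γ) := by linarith
  have h2 : 1 / (8 * Kw) = Rb * (1 / (8 * Kw * Rb)) := by field_simp
  rw [h2]
  have h3 : Rb * (1 / (8 * Kw * Rb)) < Rb * √(Real.log Γ) := mul_lt_mul_of_pos_left h1 hRb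
  linarith

/-- **The rigid-core length inequality for `Γ` large.**  `Rb > 0`, `0 ≤ Rw + cs`, `exp(((Rw + cs)/Rb)²) ≤ Γ` ⇒
`Rw√Γ + (Rb√(Γ log Γ) + cs√Γ) ≤ 2Rb√(Γ log Γ)`. [folklore] -/
theorem rigid_length_of_large {Rw Rb cs Γ : ℝ} (hRb : 0 < Rb) (hsum : 0 ≤ Rw + cs)
    (hΓ : exp (((Rw + cs) / Rb) ^ 2) ≤ Γ) :
    Rw * √Γ + (Rb * √(Γ * Real.log Γ) + cs * √Γ) ≤ 2 * Rb * √(Γ * Real.log Γ) := by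
  have hΓpos : 0 < Γ := lt_of_lt_of_le (exp_pos _) hΓ
  have ha : 0 ≤ (Rw + cs) / Rb := div_nonneg hsum hRb.le
  have h := sqrt_log_ge_of_exp_sq_le ha hΓ
  have h1 : Rw + cs ≤ Rb * √(Real.log Γ) := by
    have := mul_le_mul_of_nonneg_left h hRb.le
    rwa [mul_div_cancel₀ _ hRb.ne'] at this
  have hsplit : √(Γ * Real.log Γ) = √Γ * √(Real.log Γ) := Real.sqrt_mul hΓpos.le _
  rw [hsplit]
  have hsΓ : 0 ≤ √Γ := Real.sqrt_nonneg _
  have h2 : (Rw + cs) * √Γ ≤ Rb * √(Real.log Γ) * √Γ := mul_le_mul_of_nonneg_right h1 hsΓ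
  nlinarith [h2]

end Summit.NavierStokesRegularity.NavierStokesRegularity.Theorems.StadiumLargeGamma
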